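import Literature.Probability.Process.StableLikeJumpChainMoment
import HarnessLib

/-!
# Entropy tools: `u log u` bounds, Gibbs and Jensen–Hellinger inequalities, `∑ e^{-λ(1+‖h‖)^β}`

Support file for the proof of Bass–Levin 2002, Theorem 1.1
(`Literature.Probability.Process.bassLevin_thm_1_1`): the elementary real-variable and lattice
inequalities behind the discrete entropy–moment (Nash 1958) argument that replaces the
exit-time estimate Bass–Levin Thm 2.8 in our route.

* `abs_mul_log_le` : `|u log u| ≤ u (D + |log B|) + e^{-D/2}` for `0 ≤ u ≤ B`, `D ≥ 1`;
* `neg_mul_log_ge` : `-(u log u) ≥ -(u log B)` for `0 ≤ u ≤ B`;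
* `mul_log_div_sub_add_ge_sq` : `(√a - √b)² ≤ a log (a/b) - a + b` (`a ≥ 0`, `b > 0`);
* `exp_neg_le_factorial_mul_rpow_neg` : `e^{-t} ≤ ⌈q⌉! t^{-q}`;
* `tsum_exp_neg_rpow_le` : `∑_{h ∈ ℤ^d} e^{-λ (1+‖h‖)^β} ≤ C λ^{-d/β}` for `0 < λ ≤ 1`;
* `jensen_hellinger` : for a probability vector `w` and `0 ≤ a ≤ B`, with `ā = ∑ w a`,
  `(-ā log ā) - ∑ w (-a log a) ≥ ∑ w (√a - √ā)²`.

[folklore]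

## References
* J. Nash, *Continuity of solutions of parabolic and elliptic equations*, Amer. J. Math. 80
  (1958) 931–954 (entropy and moment bounds).
* R. F. Bass, D. A. Levin, *Transition probabilities for symmetric jump processes*,
  Trans. Amer. Math. Soc. 354 (2002) 2933–2953, Thm 2.8.
-/

noncomputable section

namespace Literature.Probability.Process

open scoped BigOperators

section RealLemmas

/-- `log t ≤ t / e` for `t > 0`. [folklore] -/
theorem log_le_div_exp_one {t : ℝ} (ht : 0 < t) : Real.log t ≤ t / Real.exp 1 := by
  have hs : 0 < t / Real.exp 1 := by positivity
  have := Real.log_le_sub_one_of_pos hs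
  rw [Real.log_div ht.ne' (Real.exp_pos 1).ne', Real.log_exp] at this
  linarith

/-- `u (-log u) ≤ (2/e) √u` for `0 < u`. [folklore] -/
theorem mul_neg_log_le_sqrt {u : ℝ} (hu : 0 < u) : u * (-Real.log u) ≤ 2 / Real.exp 1 * Real.sqrt u := by
  have hsu : 0 < Real.sqrt u := Real.sqrt_pos.mpr hu
  have hlog : -Real.log u = 2 * Real.log (1 / Real.sqrt u) := by
    rw [one_div, Real.log_inv, Real.log_sqrt hu.le]; ring
  have hle := log_le_div_exp_one (one_div_pos.mpr hsu)
  calc u * (-Real.log u) = u * (2 * Real.log (1 / Real.sqrt u)) := by rw [hlog]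
    _ ≤ u * (2 * ((1 / Real.sqrt u) / Real.exp 1)) := by
        refine mul_le_mul_of_nonneg_left ?_ hu.le
        linarith
    _ = 2 / Real.exp 1 * (u / Real.sqrt u) := by ring
    _ = 2 / Real.exp 1 * Real.sqrt u := by rw [Real.div_sqrt]

/-- **Bound on `|u log u|` for small and moderate `u`**: for `0 ≤ u ≤ B` (`B > 0`) and `D ≥ 1`,
`|u log u| ≤ u (D + |log B|) + e^{-D/2}` (for `B ≤ 0` the hypotheses force `u = 0`). [folklore] -/
theorem abs_mul_log_le {u B D : ℝ} (hu : 0 ≤ u) (huB : u ≤ B) (hD : 1 ≤ D) :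
    |u * Real.log u| ≤ u * (D + |Real.log B|) + Real.exp (-D / 2) := by
  rcases hu.eq_or_lt with h0 | hpos
  · rw [← h0]; simp [Real.exp_nonneg]
  have hexpnn : 0 ≤ Real.exp (-D / 2) := Real.exp_nonneg _
  by_cases hcase : Real.exp (-D) ≤ u
  · -- log u ∈ [-D, log B]
    have hlow : -D ≤ Real.log u := by
      have := Real.log_le_log (Real.exp_pos _) hcase
      rwa [Real.log_exp] at this
    have hup : Real.log u ≤ Real.log B := Real.log_le_log hpos huB
    have habs : |Real.log u| ≤ D + |Real.log B| := by
      rw [abs_le]; constructor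
      · linarith [abs_nonneg (Real.log B)]
      · linarith [le_abs_self (Real.log B)]
    calc |u * Real.log u| = u * |Real.log u| := by rw [abs_mul, abs_of_pos hpos]
      _ ≤ u * (D + |Real.log B|) := mul_le_mul_of_nonneg_left habs hu
      _ ≤ _ := le_add_of_nonneg_right hexpnn
  · push Not at hcase
    have hu1 : u < 1 := lt_of_lt_of_le hcase (by
      have : Real.exp (-D) ≤ Real.exp 0 := Real.exp_le_exp.mpr (by linarith)
      rwa [Real.exp_zero] at this)
    have hlogneg : Real.log u < 0 := Real.log_neg hpos hu1
    have h1 : |u * Real.log u| = u * (-Real.log u) := by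
      rw [abs_of_neg (mul_neg_of_pos_of_neg hpos hlogneg)]; ring
    have h2 := mul_neg_log_le_sqrt hpos
    have hsqrt : Real.sqrt u ≤ Real.exp (-D / 2) := by
      have hexp2 : Real.exp (-D) = Real.exp (-D / 2) * Real.exp (-D / 2) := by
        rw [← Real.exp_add]; congr 1; ring
      calc Real.sqrt u ≤ Real.sqrt (Real.exp (-D)) := Real.sqrt_le_sqrt hcase.le
        _ = Real.exp (-D / 2) := by rw [hexp2, Real.sqrt_mul_self (Real.exp_nonneg _)]
    have he : 2 / Real.exp 1 ≤ 1 := by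
      rw [div_le_one (Real.exp_pos 1)]
      have := Real.add_one_le_exp (1 : ℝ)
      linarith
    calc |u * Real.log u| = u * (-Real.log u) := h1
      _ ≤ 2 / Real.exp 1 * Real.sqrt u := h2
      _ ≤ 1 * Real.exp (-D / 2) := mul_le_mul he hsqrt (Real.sqrt_nonneg _) zero_le_one
      _ = Real.exp (-D / 2) := one_mul _
      _ ≤ _ := le_add_of_nonneg_left (by positivity)

/-- `-(u log u) ≥ -(u log B)` for `0 ≤ u ≤ B`. [folklore] -/
theorem neg_mul_log_ge {u B : ℝ} (hu : 0 ≤ u) (huB : u ≤ B) :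
    -(u * Real.log B) ≤ -(u * Real.log u) := by
  rcases hu.eq_or_lt with h0 | hpos
  · rw [← h0]; simp
  · have := Real.log_le_log hpos huB
    nlinarith

/-- **Gibbs' pointwise inequality**: `f log (f/g) ≥ f - g` for `f ≥ 0`, `g > 0`. [folklore] -/
theorem sub_le_mul_log_div {f g : ℝ} (hf : 0 ≤ f) (hg : 0 < g) :
    f - g ≤ f * Real.log (f / g) := by
  rcases hf.eq_or_lt with h0 | hpos
  · rw [← h0]; simp [hg.le]
  · have h := Real.log_le_sub_one_of_pos (div_pos hg hpos)
    have : Real.log (g / f) = -Real.log (f / g) := by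
      rw [Real.log_div hg.ne' hpos.ne', Real.log_div hpos.ne' hg.ne']; ring
    rw [this] at h
    have h2 : f * (-Real.log (f / g)) ≤ f * (g / f - 1) := mul_le_mul_of_nonneg_left h hf
    have h3 : f * (g / f - 1) = g - f := by field_simp
    linarith

/-- **Entropy controls the Hellinger distance**, pointwise form:
`(√a − √b)² ≤ a log (a/b) − a + b` for `a ≥ 0`, `b > 0`. [folklore] -/
theorem sq_sqrt_sub_sqrt_le {a b : ℝ} (ha : 0 ≤ a) (hb : 0 < b) :
    (Real.sqrt a - Real.sqrt b) ^ 2 ≤ a * Real.log (a / b) - a + b := by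
  rcases ha.eq_or_lt with h0 | hpos
  · rw [← h0]; simp [Real.sq_sqrt hb.le]
  -- with s = √(a/b): a log(a/b) - a + b = b (s² log s² - s² + 1) ≥ b (s - 1)² = (√a - √b)²
  have hsa : 0 < Real.sqrt a := Real.sqrt_pos.mpr hpos
  have hsb : 0 < Real.sqrt b := Real.sqrt_pos.mpr hb
  -- key one-variable inequality: s log s ≥ s - 1 for s = √a/√b applied as log s ≥ 1 - 1/s
  set s : ℝ := Real.sqrt a / Real.sqrt b with hs
  have hspos : 0 < s := by rw [hs]; positivity
  have hlog : 1 - 1 / s ≤ Real.log s := by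
    have := Real.log_le_sub_one_of_pos (one_div_pos.mpr hspos)
    rw [one_div, Real.log_inv] at this
    rw [one_div]; linarith
  have hab : a / b = s ^ 2 := by
    rw [hs, div_pow, Real.sq_sqrt ha, Real.sq_sqrt hb.le]
  have hlog2 : Real.log (a / b) = 2 * Real.log s := by
    rw [hab, Real.log_pow]; norm_num
  -- (√a - √b)² = a - 2 √a √b + b, and a log(a/b) = 2 a log s ≥ 2a(1 - 1/s) = 2a - 2 √a √b
  have hsq : (Real.sqrt a - Real.sqrt b) ^ 2 = a - 2 * (Real.sqrt a * Real.sqrt b) + b := by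
    rw [sub_sq, Real.sq_sqrt ha, Real.sq_sqrt hb.le]; ring
  have hainv : a * (1 / s) = Real.sqrt a * Real.sqrt b := by
    rw [hs, one_div_div]
    calc a * (Real.sqrt b / Real.sqrt a) = (a / Real.sqrt a) * Real.sqrt b := by ring
      _ = Real.sqrt a * Real.sqrt b := by rw [Real.div_sqrt]
  have hkey : 2 * a * (1 - 1 / s) ≤ a * Real.log (a / b) := by
    rw [hlog2]
    have := mul_le_mul_of_nonneg_left hlog ha
    linarith
  have : 2 * a * (1 - 1 / s) = 2 * a - 2 * (Real.sqrt a * Real.sqrt b) := by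
    rw [← hainv]; ring
  rw [hsq]; linarith

/-- `e^{-t} ≤ ⌈q⌉! · t^{-q}` for `t, q > 0`. [folklore] -/
theorem exp_neg_le_factorial_mul_rpow_neg {t q : ℝ} (ht : 0 < t) (hq : 0 < q) :
    Real.exp (-t) ≤ (Nat.factorial ⌈q⌉₊ : ℝ) * t ^ (-q) := by
  set n : ℕ := ⌈q⌉₊ with hn
  have hnq : q ≤ n := Nat.le_ceil q
  have hfac : (1 : ℝ) ≤ (Nat.factorial n : ℝ) := by exact_mod_cast Nat.one_le_iff_ne_zero.mpr (Nat.factorial_ne_zero n)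
  rcases le_or_gt 1 t with h1 | h1
  · -- t ≥ 1: e^{-t} ≤ n!/t^n ≤ n! t^{-q}
    have hpow := Real.pow_div_factorial_le_exp t ht.le n
    have hfpos : (0 : ℝ) < Nat.factorial n := by positivity
    have h2 : Real.exp (-t) ≤ (Nat.factorial n : ℝ) * t ^ (-(n : ℝ)) := by
      rw [Real.exp_neg, Real.rpow_neg ht.le, Real.rpow_natCast]
      rw [div_le_iff₀ hfpos] at hpow
      have htn : 0 < t ^ n := pow_pos ht n
      rw [inv_le_iff_one_le_mul₀ (Real.exp_pos t)]
      calc (1 : ℝ) = (t ^ n)⁻¹ * t ^ n := by rw [inv_mul_cancel₀ htn.ne']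
        _ ≤ (t ^ n)⁻¹ * (Real.exp t * Nat.factorial n) := mul_le_mul_of_nonneg_left hpow (by positivity)
        _ = (Nat.factorial n : ℝ) * (t ^ n)⁻¹ * Real.exp t := by ring
    calc Real.exp (-t) ≤ (Nat.factorial n : ℝ) * t ^ (-(n : ℝ)) := h2
      _ ≤ (Nat.factorial n : ℝ) * t ^ (-q) :=
          mul_le_mul_of_nonneg_left (Real.rpow_le_rpow_of_exponent_le h1 (by linarith)) (by positivity)
  · -- t < 1: e^{-t} ≤ 1 ≤ t^{-q} ≤ n! t^{-q}
    have h2 : Real.exp (-t) ≤ 1 := Real.exp_le_one_iff.mpr (by linarith)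
    have h3 : (1 : ℝ) ≤ t ^ (-q) := Real.one_le_rpow_of_pos_of_le_one_of_nonpos ht h1.le (by linarith)
    calc Real.exp (-t) ≤ 1 := h2
      _ ≤ 1 * t ^ (-q) := by linarith
      _ ≤ (Nat.factorial n : ℝ) * t ^ (-q) := mul_le_mul_of_nonneg_right hfac (by positivity)

end RealLemmas

section LatticeExp

variable {d : ℕ}

/-- **The partition function of `e^{-λ(1+‖h‖)^β}` on `ℤ^d`**: for `0 < β`, `0 < λ ≤ 1`,
`∑_h e^{-λ (1+‖h‖)^β} ≤ C λ^{-d/β}` with `C` depending only on `d, β` (and the family is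
summable). [folklore] -/
theorem tsum_exp_neg_rpow_le (hd : 1 ≤ d) {β : ℝ} (hβ : 0 < β) :
    ∃ C : ℝ, 0 < C ∧ ∀ lam : ℝ, 0 < lam → lam ≤ 1 →
      (Summable fun h : Fin d → ℤ => Real.exp (-lam * (1 + ‖h‖) ^ β)) ∧
      ∑' h : Fin d → ℤ, Real.exp (-lam * (1 + ‖h‖) ^ β) ≤ C * lam ^ (-(d : ℝ) / β) := by
  set q : ℝ := ((d : ℝ) + 1) / β with hq
  have hqpos : 0 < q := by rw [hq]; positivity
  have hβq : β * q = (d : ℝ) + 1 := by rw [hq]; field_simp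
  set cq : ℝ := (Nat.factorial ⌈q⌉₊ : ℝ) with hcq
  have hcq1 : 1 ≤ cq := by rw [hcq]; exact_mod_cast Nat.one_le_iff_ne_zero.mpr (Nat.factorial_ne_zero _)
  have ht : (d : ℝ) < (d : ℝ) + 1 := by linarith
  set L : ℝ := 2 * d * 3 ^ (d - 1) / (((d : ℝ) + 1) - d) with hL
  have hLnn : 0 ≤ L := by
    have h1 : ((d : ℝ) + 1) - d = 1 := by ring
    rw [hL, h1]; positivity
  refine ⟨(6 : ℝ) ^ d + cq * L + 1, by positivity, fun lam hlam hlam1 => ?_⟩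
  -- the scale K = ⌈lam^{-1/β}⌉ ≥ 1
  set R : ℝ := lam ^ (-1 / β) with hR
  have hR1 : 1 ≤ R := by
    rw [hR]; exact Real.one_le_rpow_of_pos_of_le_one_of_nonpos hlam hlam1 (by
      rw [neg_div]; exact neg_nonpos.mpr (by positivity))
  have hRpos : 0 < R := by linarith
  set K : ℕ := ⌈R⌉₊ with hK
  have hK1 : 1 ≤ K := Nat.succ_le_of_lt (Nat.ceil_pos.mpr hRpos)
  have hRK : R ≤ (K : ℝ) := Nat.le_ceil R
  have hKR : (K : ℝ) < R + 1 := Nat.ceil_lt_add_one hRpos.le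
  have hK0 : (0 : ℝ) < K := by exact_mod_cast hK1
  -- majorant F(h) := (if ‖h‖ ≤ K then 1 else 0) + (if K < ‖h‖ then cq λ^{-q} ‖h‖^{-(d+1)} else 0)
  obtain ⟨Fn, hFn⟩ : ∃ Fn : (Fin d → ℤ) → ℝ, ∀ h, Fn h = if ‖h‖ ≤ K then (1 : ℝ) else 0 :=
    ⟨_, fun h => rfl⟩
  obtain ⟨Ff, hFf⟩ : ∃ Ff : (Fin d → ℤ) → ℝ, ∀ h, Ff h =
      if (K : ℝ) < ‖h‖ then (cq * lam ^ (-q)) * ‖h‖ ^ (-((d : ℝ) + 1)) else 0 := ⟨_, fun h => rfl⟩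
  obtain ⟨hfs, -, hfle⟩ := far_majorant_tsum_le hd ht (A := cq * lam ^ (-q)) (by positivity) K Ff hFf
  -- near part
  set B : Finset (Fin d → ℤ) := Fintype.piFinset (fun _ : Fin d => Finset.Icc (-(K : ℤ)) K) with hB
  have hsupp : ∀ h, h ∉ B → Fn h = 0 := by
    intro h hh; rw [hFn, if_neg]; exact fun hc => hh ((mem_box_iff h K).mpr hc)
  have hns : Summable Fn := summable_of_ne_finset_zero hsupp
  have hnle : ∑' h, Fn h ≤ (6 : ℝ) ^ d * lam ^ (-(d : ℝ) / β) := by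
    rw [tsum_eq_sum hsupp]
    have h1 : ∑ h ∈ B, Fn h ≤ ∑ h ∈ B, (1 : ℝ) := Finset.sum_le_sum fun h _ => by
      rw [hFn]; split_ifs <;> norm_num
    rw [Finset.sum_const, nsmul_eq_mul, mul_one, card_box] at h1
    push_cast at h1
    refine h1.trans ?_
    have hK2 : (K : ℝ) ≤ 2 * R := by linarith
    have hRpow : R ^ (d : ℝ) = lam ^ (-(d : ℝ) / β) := by
      rw [hR, ← Real.rpow_mul hlam.le]; congr 1; field_simp
    calc (2 * (K : ℝ) + 1) ^ d ≤ ((6 : ℝ) * R) ^ d :=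
          pow_le_pow_left₀ (by positivity) (by linarith) d
      _ = (6 : ℝ) ^ d * R ^ (d : ℝ) := by rw [mul_pow, Real.rpow_natCast]
      _ = (6 : ℝ) ^ d * lam ^ (-(d : ℝ) / β) := by rw [hRpow]
  -- far part: L K^{d-(d+1)} = L / K ≤ L λ^{1/β}·... and λ^{-q} λ^{1/β} = λ^{-d/β}
  have hfle' : ∑' h, Ff h ≤ cq * L * lam ^ (-(d : ℝ) / β) := by
    have h := hfle hK1
    have hKpow : (K : ℝ) ^ ((d : ℝ) - ((d : ℝ) + 1)) ≤ R ^ ((d : ℝ) - ((d : ℝ) + 1)) :=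
      Real.rpow_le_rpow_of_nonpos hRpos hRK (by linarith)
    have hRexp : lam ^ (-q) * R ^ ((d : ℝ) - ((d : ℝ) + 1)) = lam ^ (-(d : ℝ) / β) := by
      rw [hR, ← Real.rpow_mul hlam.le, ← Real.rpow_add hlam]
      congr 1; rw [hq]; field_simp; ring
    calc ∑' h, Ff h ≤ cq * lam ^ (-q) * L * (K : ℝ) ^ ((d : ℝ) - ((d : ℝ) + 1)) := by
          rw [hL]; convert h using 2
      _ ≤ cq * lam ^ (-q) * L * R ^ ((d : ℝ) - ((d : ℝ) + 1)) :=
          mul_le_mul_of_nonneg_left hKpow (by positivity)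
      _ = cq * L * (lam ^ (-q) * R ^ ((d : ℝ) - ((d : ℝ) + 1))) := by ring
      _ = cq * L * lam ^ (-(d : ℝ) / β) := by rw [hRexp]
  -- pointwise domination
  have hpt : ∀ h : Fin d → ℤ, Real.exp (-lam * (1 + ‖h‖) ^ β) ≤ Fn h + Ff h := by
    intro h
    have hFn_nn : 0 ≤ Fn h := by rw [hFn]; split_ifs <;> norm_num
    have hFf_nn : 0 ≤ Ff h := by
      rw [hFf]; split_ifs
      · positivity
      · exact le_rfl
    by_cases hc : ‖h‖ ≤ K
    · rw [hFn, if_pos hc]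
      have : Real.exp (-lam * (1 + ‖h‖) ^ β) ≤ 1 := by
        refine Real.exp_le_one_iff.mpr ?_
        have : 0 ≤ lam * (1 + ‖h‖) ^ β := by positivity
        linarith
      linarith
    · push Not at hc
      rw [hFf, if_pos hc]
      have hpos : 0 < ‖h‖ := lt_of_le_of_lt (Nat.cast_nonneg K) hc
      -- e^{-λ(1+‖h‖)^β} ≤ e^{-λ‖h‖^β} ≤ cq (λ‖h‖^β)^{-q}
      have h1 : Real.exp (-lam * (1 + ‖h‖) ^ β) ≤ Real.exp (-(lam * ‖h‖ ^ β)) := by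
        refine Real.exp_le_exp.mpr ?_
        have : ‖h‖ ^ β ≤ (1 + ‖h‖) ^ β := Real.rpow_le_rpow (norm_nonneg _) (by linarith) hβ.le
        nlinarith
      have h2 := exp_neg_le_factorial_mul_rpow_neg (t := lam * ‖h‖ ^ β) (by positivity) hqpos
      have h3 : (lam * ‖h‖ ^ β) ^ (-q) = lam ^ (-q) * ‖h‖ ^ (-((d : ℝ) + 1)) := by
        rw [Real.mul_rpow hlam.le (Real.rpow_nonneg (norm_nonneg _) _), ← Real.rpow_mul (norm_nonneg _)]
        congr 2; rw [← hβq]; ring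
      calc Real.exp (-lam * (1 + ‖h‖) ^ β) ≤ Real.exp (-(lam * ‖h‖ ^ β)) := h1
        _ ≤ cq * (lam * ‖h‖ ^ β) ^ (-q) := by rw [hcq]; exact h2
        _ = cq * lam ^ (-q) * ‖h‖ ^ (-((d : ℝ) + 1)) := by rw [h3]; ring
        _ ≤ Fn h + cq * lam ^ (-q) * ‖h‖ ^ (-((d : ℝ) + 1)) := le_add_of_nonneg_left hFn_nn
  have hnn : ∀ h : Fin d → ℤ, 0 ≤ Real.exp (-lam * (1 + ‖h‖) ^ β) := fun h => Real.exp_nonneg _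
  have hsum : Summable fun h : Fin d → ℤ => Real.exp (-lam * (1 + ‖h‖) ^ β) :=
    (hns.add hfs).of_nonneg_of_le hnn hpt
  refine ⟨hsum, ?_⟩
  have hlampow : 0 ≤ lam ^ (-(d : ℝ) / β) := Real.rpow_nonneg hlam.le _
  calc ∑' h : Fin d → ℤ, Real.exp (-lam * (1 + ‖h‖) ^ β) ≤ ∑' h, (Fn h + Ff h) :=
        Summable.tsum_le_tsum hpt hsum (hns.add hfs)
    _ = ∑' h, Fn h + ∑' h, Ff h := Summable.tsum_add hns hfs
    _ ≤ (6 : ℝ) ^ d * lam ^ (-(d : ℝ) / β) + cq * L * lam ^ (-(d : ℝ) / β) := add_le_add hnle hfle'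
    _ = ((6 : ℝ) ^ d + cq * L) * lam ^ (-(d : ℝ) / β) := by ring
    _ ≤ ((6 : ℝ) ^ d + cq * L + 1) * lam ^ (-(d : ℝ) / β) :=
        mul_le_mul_of_nonneg_right (by linarith) hlampow

end LatticeExp

section Jensen

variable {S : Type*}

/-- `|u log u|` is bounded on `[0, B]`: `|u log u| ≤ B (1 + |log B|) + 1`. [folklore] -/
theorem abs_mul_log_le_const {u B : ℝ} (hu : 0 ≤ u) (huB : u ≤ B) :
    |u * Real.log u| ≤ B * (1 + |Real.log B|) + 1 := by
  have h := abs_mul_log_le hu huB le_rfl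
  have h1 : u * (1 + |Real.log B|) ≤ B * (1 + |Real.log B|) :=
    mul_le_mul_of_nonneg_right huB (by positivity)
  have h2 : Real.exp (-(1 : ℝ) / 2) ≤ 1 := by
    rw [← Real.exp_zero]; exact Real.exp_le_exp.mpr (by norm_num)
  linarith

/-- **Jensen–Hellinger inequality for a countable convex combination.** For a probability
vector `w` (`w ≥ 0`, `∑ w = 1`) and `0 ≤ a ≤ B`, with `ā = ∑ w a`:
`-(ā log ā) - ∑_z w_z (-(a_z log a_z)) ≥ ∑_z w_z (√a_z - √ā)²`
(the entropy gained by averaging dominates the Hellinger spread). All the series involved are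
summable. [folklore] -/
theorem jensen_hellinger {w a : S → ℝ} {B : ℝ} (hw : ∀ z, 0 ≤ w z) (hw1 : HasSum w 1)
    (ha : ∀ z, 0 ≤ a z) (haB : ∀ z, a z ≤ B) :
    (Summable fun z => w z * a z) ∧
    (Summable fun z => w z * (a z * Real.log (a z))) ∧
    (Summable fun z => w z * (Real.sqrt (a z) - Real.sqrt (∑' u, w u * a u)) ^ 2) ∧
    ∑' z, w z * (Real.sqrt (a z) - Real.sqrt (∑' u, w u * a u)) ^ 2 ≤
      -((∑' u, w u * a u) * Real.log (∑' u, w u * a u)) + ∑' z, w z * (a z * Real.log (a z)) := by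
  have hws : Summable w := hw1.summable
  have hwa : Summable fun z => w z * a z :=
    (hws.mul_right B).of_nonneg_of_le (fun z => mul_nonneg (hw z) (ha z))
      (fun z => mul_le_mul_of_nonneg_left (haB z) (hw z))
  set abar : ℝ := ∑' u, w u * a u with habar
  have habar_nn : 0 ≤ abar := tsum_nonneg fun z => mul_nonneg (hw z) (ha z)
  have habar_B : abar ≤ B := by
    calc abar ≤ ∑' u, w u * B := Summable.tsum_le_tsum (fun z => mul_le_mul_of_nonneg_left (haB z) (hw z))
          hwa (hws.mul_right B)
      _ = B := by rw [tsum_mul_right, hw1.tsum_eq, one_mul]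
  -- bounded functions against w are summable
  have hbd_summable : ∀ {g : S → ℝ} {C : ℝ}, (∀ z, |g z| ≤ C) → Summable fun z => w z * g z := by
    intro g C hg
    refine Summable.of_norm ?_
    refine ((hws.mul_right C)).of_nonneg_of_le (fun z => norm_nonneg _) (fun z => ?_)
    rw [Real.norm_eq_abs, abs_mul, abs_of_nonneg (hw z)]
    exact mul_le_mul_of_nonneg_left (hg z) (hw z)
  have hlog_s : Summable fun z => w z * (a z * Real.log (a z)) :=
    hbd_summable (fun z => abs_mul_log_le_const (ha z) (haB z))
  have hsq_bd : ∀ z, |(Real.sqrt (a z) - Real.sqrt abar) ^ 2| ≤ 2 * B := by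
    intro z
    rw [abs_of_nonneg (sq_nonneg _)]
    have h1 : (Real.sqrt (a z) - Real.sqrt abar) ^ 2 ≤ a z + abar := by
      rw [sub_sq, Real.sq_sqrt (ha z), Real.sq_sqrt habar_nn]
      nlinarith [Real.sqrt_nonneg (a z), Real.sqrt_nonneg abar]
    linarith [haB z]
  have hsq_s : Summable fun z => w z * (Real.sqrt (a z) - Real.sqrt abar) ^ 2 := hbd_summable hsq_bd
  refine ⟨hwa, hlog_s, hsq_s, ?_⟩
  rcases habar_nn.eq_or_lt with h0 | hpos
  · -- abar = 0: every term w z * a z vanishes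
    have hzero : ∀ z, w z * a z = 0 := by
      have := (hasSum_zero_iff_of_nonneg (fun z => mul_nonneg (hw z) (ha z))).mp (by
        rw [h0]; exact hwa.hasSum)
      exact fun z => congrFun this z
    have h1 : ∀ z, w z * (Real.sqrt (a z) - Real.sqrt abar) ^ 2 = 0 := by
      intro z
      rw [← h0, Real.sqrt_zero, sub_zero, Real.sq_sqrt (ha z)]
      exact hzero z
    have h2 : ∀ z, w z * (a z * Real.log (a z)) = 0 := by
      intro z
      rcases mul_eq_zero.mp (hzero z) with hw0 | ha0
      · rw [hw0, zero_mul]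
      · rw [ha0]; simp
    rw [tsum_congr h1, tsum_zero, tsum_congr h2, tsum_zero, ← h0]
    simp
  · -- abar > 0: sum the pointwise inequality (√a - √ā)² ≤ a log(a/ā) - a + ā
    have hpt : ∀ z, w z * (Real.sqrt (a z) - Real.sqrt abar) ^ 2 ≤
        w z * (a z * Real.log (a z)) - Real.log abar * (w z * a z) - w z * a z + abar * w z := by
      intro z
      have h := sq_sqrt_sub_sqrt_le (ha z) hpos
      have hsplit : a z * Real.log (a z / abar) = a z * Real.log (a z) - Real.log abar * a z := by
        rcases (ha z).eq_or_lt with h0 | hap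
        · rw [← h0]; simp
        · rw [Real.log_div hap.ne' hpos.ne']; ring
      rw [hsplit] at h
      have := mul_le_mul_of_nonneg_left h (hw z)
      nlinarith
    have hrhs_s : Summable fun z =>
        w z * (a z * Real.log (a z)) - Real.log abar * (w z * a z) - w z * a z + abar * w z :=
      ((hlog_s.sub (hwa.mul_left _)).sub hwa).add (hws.mul_left _)
    calc ∑' z, w z * (Real.sqrt (a z) - Real.sqrt abar) ^ 2
        ≤ ∑' z, (w z * (a z * Real.log (a z)) - Real.log abar * (w z * a z) - w z * a z + abar * w z) :=
          Summable.tsum_le_tsum hpt hsq_s hrhs_s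
      _ = ∑' z, w z * (a z * Real.log (a z)) - Real.log abar * abar - abar + abar * 1 := by
          rw [Summable.tsum_add ((hlog_s.sub (hwa.mul_left _)).sub hwa) (hws.mul_left _),
            Summable.tsum_sub (hlog_s.sub (hwa.mul_left _)) hwa,
            Summable.tsum_sub hlog_s (hwa.mul_left _), tsum_mul_left, tsum_mul_left, hw1.tsum_eq]
      _ = -(abar * Real.log abar) + ∑' z, w z * (a z * Real.log (a z)) := by ring

end Jensen

end Literature.Probability.Process
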